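import Literature.Geometry.Lorentzian.KerrIngoingCoordChristoffel
import Literature.Geometry.Lorentzian.RicciDecay
import HarnessLib

/-!
# The Kerr metric in ingoing Kerr coordinates `(t*, r, μ, φ)`, IV: the Ricci tensor vanishes

Infrastructure (all results proved) for `Kerr.isRicciFlat M a r₀` (all spins): **every smooth
metric on an open subset of the coordinate space whose components are the rational Kerr components
`Kerr.Ingoing.bilin M a` (on the regular set `{Σ ≠ 0, μ² ≠ 1}`) is Ricci-flat**
(`Kerr.Ingoing.ricci_eq_zero_of_repr`). This is the computational core of "the Kerr metric is a
vacuum solution" (Kerr, PRL 11 (1963); Kerr–Schild 1965, §3; O'Neill 1995, Ch. 2, Thm. 2.6.1):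
expand `Ric_x(∂_k, ∂_l)` by the coordinate formula `OpensChart.ricci_eq_coord` (O'Neill 1983,
Lemma 3.38 with Lemma 3.52) with the explicit inverse Gram matrix `Kerr.Ingoing.ginvMat`
(`g⁻¹ = η_K⁻¹ − 2H ℓ♯ ⊗ ℓ♯`: entries `−1−2H, 2H, Δ/Σ, a/Σ, (1−μ²)/Σ, 1/(Σ(1−μ²))`), the closed-form
Koszul form and its derivative (`KerrIngoingCoordChristoffel.lean`), and close each of the sixteen
components — rational identities in `r, μ, M, a` — by `field_simp`/`ring` (this file: the inverse
Gram matrix, the expansion `ricci_basis_aux`, and the eight components `Ric(∂_k, ∂_l)`, `k = 0, 1`;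
the remaining eight and the conclusion are in `KerrIngoingCoordRicciFlat.lean`). The chart identity
of `KerrIngoingCoordPullback.lean` and naturality of the Ricci tensor then give `Ric(g_{M,a}) = 0` on
the Kerr–Schild chart (`KerrRicciFlat.lean`).

## References

* R. P. Kerr, Phys. Rev. Lett. 11 (1963) 237–238; R. P. Kerr, A. Schild (1965), §3.
* B. O'Neill, *The geometry of Kerr black holes* (1995), Ch. 2, Thm. 2.6.1; *Semi-Riemannian
  geometry* (1983), Ch. 3, Lemma 3.38, Lemma 3.52.
* M. Visser, arXiv:0706.0622, (E:K1)–(E:K2).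
-/

noncomputable section

set_option maxSynthPendingDepth 3

open Bundle TopologicalSpace Manifold Set Module Filter
open scoped ContDiff Topology

namespace Literature.Geometry.Lorentzian

namespace Kerr

namespace Ingoing

/-! ### The Gram matrix on the coordinate basis and its inverse -/

/-- **The inverse metric in ingoing Kerr coordinates**: `g⁻¹ = η_K⁻¹ − 2H (∂_r − ∂_{t*})²`,
`η_K⁻¹ = −∂_{t*}² + ((r²+a²)/Σ) ∂_r² + (a/Σ)(∂_r ∂_φ + ∂_φ ∂_r) + ((1−μ²)/Σ) ∂_μ² + ∂_φ²/(Σ(1−μ²))`.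
Visser arXiv:0706.0622, (E:K2) (inverse of the Kerr form). [cite: arXiv07060622, (E:K2)] -/
def ginvMat (M a : ℝ) (u : E4) : Matrix (Fin 4) (Fin 4) ℝ :=
  !![-(1 + h00 M a u), h00 M a u, 0, 0;
     h00 M a u, (u 1 ^ 2 + a ^ 2) / sigma a u - h00 M a u, 0, a / sigma a u;
     0, 0, sinSq u / sigma a u, 0;
     0, a / sigma a u, 0, 1 / (sigma a u * sinSq u)]

variable (M a : ℝ) {u : E4}

/-- The components on the coordinate basis: `g(∂_i, ∂_j)`. [cite: arXiv07060622, (E:K1)] -/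
theorem bilin_basisVector (u : E4) (i j : Fin 4) :
    bilin M a u (E4.basisVector i) (E4.basisVector j) =
      !![-1 + h00 M a u, h00 M a u, 0, h03 M a u;
         h00 M a u, 1 + h00 M a u, 0, c13 a u + h03 M a u;
         0, 0, c22 a u, 0;
         h03 M a u, c13 a u + h03 M a u, 0, c33 M a u] i j := by
  fin_cases i <;> fin_cases j <;>
    simp [bilin_apply, E4.basisVector, Fin.reduceEq]

/-- `g · g⁻¹ = 1` on the regular set (`det g = −Σ²`). [cite: arXiv07060622, (E:K2)] -/
theorem gram_mul_ginvMat (hu : u ∈ regularSet a) :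
    !![-1 + h00 M a u, h00 M a u, 0, h03 M a u;
         h00 M a u, 1 + h00 M a u, 0, c13 a u + h03 M a u;
         0, 0, c22 a u, 0;
         h03 M a u, c13 a u + h03 M a u, 0, c33 M a u] * ginvMat M a u =
      (1 : Matrix (Fin 4) (Fin 4) ℝ) := by
  have hS := hu.1
  have hP := hu.2
  ext k l
  fin_cases k <;> fin_cases l <;>
    simp [ginvMat, Matrix.mul_apply, Fin.sum_univ_four, h00, h03, c13, c22, c33, scalarH, sigma,
      sinSq] at hS hP ⊢ <;> field_simp <;> ring

/-- **The inverse Gram matrix of the Kerr components on the coordinate basis** is `ginvMat`.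
[cite: arXiv07060622, (E:K2)] -/
theorem gram_inv (hu : u ∈ regularSet a) :
    (Matrix.of fun i j ↦ bilin M a u (E4.basisVector i) (E4.basisVector j))⁻¹ = ginvMat M a u := by
  have h : (Matrix.of fun i j ↦ bilin M a u (E4.basisVector i) (E4.basisVector j)) =
      !![-1 + h00 M a u, h00 M a u, 0, h03 M a u;
         h00 M a u, 1 + h00 M a u, 0, c13 a u + h03 M a u;
         0, 0, c22 a u, 0;
         h03 M a u, c13 a u + h03 M a u, 0, c33 M a u] := by
    ext i j
    rw [Matrix.of_apply, bilin_basisVector]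
  rw [h]
  exact Matrix.inv_eq_right_inv (gram_mul_ginvMat M a hu)

/-! ### The Ricci tensor of a metric with these components -/

section Ricci

variable {U : Opens E4}
  (g' : PseudoRiemannianMetric 𝓘(ℝ, E4) ∞ E4 (TangentSpace 𝓘(ℝ, E4) : U → Type _))
  [g'.HasLeviCivita] (hG : ∀ y : U, g'.val y = bilin M a y) (x : U) (hx : (x : E4) ∈ regularSet a)

include hG hx in
/-- **The coordinate components of the Ricci tensor, explicitly**: `Ric_x(∂_k, ∂_l)` is the
coordinate expression `OpensChart.ricci_eq_coord` with inverse Gram matrix `ginvMat`, for every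
smooth metric with components `Kerr.Ingoing.bilin M a` (O'Neill 1983, Ch. 3, Lemma 3.38 and
Lemma 3.52). [cite: ONeill1983, Ch. 3, Lemma 3.52] -/
theorem ricci_basis_aux (k l : Fin 4) :
    g'.ricci x (E4.basisVector k) (E4.basisVector l) =
      ∑ i, ∑ j, ginvMat M a x j i *
        (2⁻¹ * (fderiv ℝ (fun y ↦ OpensChart.koszulForm (bilin M a) y (E4.basisVector l)
              (E4.basisVector k) (E4.basisVector j)) x (E4.basisVector i)
            - fderiv ℝ (fun y ↦ OpensChart.koszulForm (bilin M a) y (E4.basisVector l)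
              (E4.basisVector i) (E4.basisVector j)) x (E4.basisVector k))
          - ∑ b, ∑ c, ginvMat M a x c b *
              (2⁻¹ * OpensChart.koszulForm (bilin M a) x (E4.basisVector j) (E4.basisVector i)
                (E4.basisVector c)) *
              (2⁻¹ * OpensChart.koszulForm (bilin M a) x (E4.basisVector l) (E4.basisVector k)
                (E4.basisVector b))
          + ∑ b, ∑ c, ginvMat M a x c b *
              (2⁻¹ * OpensChart.koszulForm (bilin M a) x (E4.basisVector j) (E4.basisVector k)
                (E4.basisVector c)) *
              (2⁻¹ * OpensChart.koszulForm (bilin M a) x (E4.basisVector l) (E4.basisVector i)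
                (E4.basisVector b))) := by
  set β : Module.Basis (Fin 4) ℝ (TangentSpace 𝓘(ℝ, E4) x) :=
    (EuclideanSpace.basisFun (Fin 4) ℝ).toBasis with hβdef
  have hβ : ∀ i, β i = E4.basisVector i := fun i ↦ by
    rw [hβdef]
    exact (congrFun (EuclideanSpace.basisFun (Fin 4) ℝ).coe_toBasis i).trans
      (EuclideanSpace.basisFun_apply _ _ i)
  have h := OpensChart.ricci_eq_coord hG x β k l
  simp only [hβ] at h
  rw [h, gram_inv M a hx]

/-- Components of the coordinate basis vectors: `(∂_i)_j = δ_{ij}`. [folklore] -/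
theorem bv_apply (i j : Fin 4) : E4.basisVector i j = if j = i then 1 else 0 :=
  PiLp.single_apply _ _ _ _ _

include hG hx in
/-- A component of `Kerr.Ingoing.ricci_basis`: `Ric(∂_0, ∂_0) = 0` for the Kerr components.
[cite: KerrSchild1965, §3] -/
theorem ricci_basisVector_00 : g'.ricci x (E4.basisVector 0) (E4.basisVector 0) = 0 := by
  have hS := hx.1
  have hP := hx.2
  rw [ricci_basis_aux M a g' hG x hx]
  simp only [ginvMat, Fin.sum_univ_four, Matrix.of_apply, Matrix.cons_val', Matrix.cons_val_zero,
    Matrix.cons_val_one, Matrix.cons_val, Matrix.empty_val', Matrix.cons_val_fin_one, Fin.isValue,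
    zero_mul, add_zero, zero_add]
  simp only [fderiv_koszulForm_bilin M a hx, koszulForm_bilin M a hx, dKoszulR, dKoszulM,
    bilinR_apply, bilinM_apply, bilinRR_apply, bilinRM_apply, bilinMM_apply, bv_apply, Fin.isValue,
    Fin.reduceEq, if_true, if_false, mul_one, one_mul, mul_zero, zero_mul, add_zero, zero_add,
    sub_zero, zero_sub]
  simp only [h00, c22r, c22m, c33r, c33m, h00r, h00m, h03r, h03m, h00rr, h00mm, scalarH, scalarHr,
    scalarHm, scalarHrr, scalarHmm, sigma, sinSq] at hS hP ⊢
  field_simp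
  ring

include hG hx in
/-- A component of `Kerr.Ingoing.ricci_basis`: `Ric(∂_0, ∂_1) = 0` for the Kerr components.
[cite: KerrSchild1965, §3] -/
theorem ricci_basisVector_01 : g'.ricci x (E4.basisVector 0) (E4.basisVector 1) = 0 := by
  have hS := hx.1
  have hP := hx.2
  rw [ricci_basis_aux M a g' hG x hx]
  simp only [ginvMat, Fin.sum_univ_four, Matrix.of_apply, Matrix.cons_val', Matrix.cons_val_zero,
    Matrix.cons_val_one, Matrix.cons_val, Matrix.empty_val', Matrix.cons_val_fin_one, Fin.isValue,
    zero_mul, add_zero, zero_add]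
  simp only [fderiv_koszulForm_bilin M a hx, koszulForm_bilin M a hx, dKoszulR, dKoszulM,
    bilinR_apply, bilinM_apply, bilinRR_apply, bilinRM_apply, bilinMM_apply, bv_apply, Fin.isValue,
    Fin.reduceEq, if_true, if_false, mul_one, one_mul, mul_zero, zero_mul, add_zero, zero_add,
    sub_zero, zero_sub]
  simp only [h00, c22r, c22m, c33r, c33m, h00r, h00m, h03r, h03m, h00rr, h00mm, h03rr, scalarH,
    scalarHr, scalarHm, scalarHrr, scalarHmm, sigma, sinSq] at hS hP ⊢
  field_simp
  ring

include hG hx in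
/-- A component of `Kerr.Ingoing.ricci_basis`: `Ric(∂_0, ∂_2) = 0` for the Kerr components.
[cite: KerrSchild1965, §3] -/
theorem ricci_basisVector_02 : g'.ricci x (E4.basisVector 0) (E4.basisVector 2) = 0 := by
  have hS := hx.1
  have hP := hx.2
  rw [ricci_basis_aux M a g' hG x hx]
  simp only [ginvMat, Fin.sum_univ_four, Matrix.of_apply, Matrix.cons_val', Matrix.cons_val_zero,
    Matrix.cons_val_one, Matrix.cons_val, Matrix.empty_val', Matrix.cons_val_fin_one, Fin.isValue,
    zero_mul, add_zero, zero_add]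
  simp only [fderiv_koszulForm_bilin M a hx, koszulForm_bilin M a hx, dKoszulR, dKoszulM,
    bilinR_apply, bilinM_apply, bilinRR_apply, bilinRM_apply, bilinMM_apply, bv_apply, Fin.isValue,
    Fin.reduceEq, if_true, if_false, mul_one, one_mul, mul_zero, zero_mul, add_zero, zero_add,
    sub_zero, zero_sub]
  simp only [h00, c22r, c33r, c33m, h00r, h00m, h03r, h03m, h00rm, h03rm, scalarH, scalarHr,
    scalarHm, scalarHrm, sigma, sinSq] at hS hP ⊢
  field_simp
  ring

include hG hx in
/-- A component of `Kerr.Ingoing.ricci_basis`: `Ric(∂_0, ∂_3) = 0` for the Kerr components.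
[cite: KerrSchild1965, §3] -/
theorem ricci_basisVector_03 : g'.ricci x (E4.basisVector 0) (E4.basisVector 3) = 0 := by
  have hS := hx.1
  have hP := hx.2
  rw [ricci_basis_aux M a g' hG x hx]
  simp only [ginvMat, Fin.sum_univ_four, Matrix.of_apply, Matrix.cons_val', Matrix.cons_val_zero,
    Matrix.cons_val_one, Matrix.cons_val, Matrix.empty_val', Matrix.cons_val_fin_one, Fin.isValue,
    zero_mul, add_zero, zero_add]
  simp only [fderiv_koszulForm_bilin M a hx, koszulForm_bilin M a hx, dKoszulR, dKoszulM,
    bilinR_apply, bilinM_apply, bilinRR_apply, bilinRM_apply, bilinMM_apply, bv_apply, Fin.isValue,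
    Fin.reduceEq, if_true, if_false, mul_one, one_mul, mul_zero, zero_mul, add_zero, zero_add,
    sub_zero, zero_sub]
  simp only [h00, c22r, c22m, c33r, c33m, h00r, h00m, h03r, h03m, h00rr, h00mm, h03rr, h03mm,
    scalarH, scalarHr, scalarHm, scalarHrr, scalarHmm, sigma, sinSq] at hS hP ⊢
  field_simp
  ring

include hG hx in
/-- A component of `Kerr.Ingoing.ricci_basis`: `Ric(∂_1, ∂_0) = 0` for the Kerr components.
[cite: KerrSchild1965, §3] -/
theorem ricci_basisVector_10 : g'.ricci x (E4.basisVector 1) (E4.basisVector 0) = 0 := by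
  have hS := hx.1
  have hP := hx.2
  rw [ricci_basis_aux M a g' hG x hx]
  simp only [ginvMat, Fin.sum_univ_four, Matrix.of_apply, Matrix.cons_val', Matrix.cons_val_zero,
    Matrix.cons_val_one, Matrix.cons_val, Matrix.empty_val', Matrix.cons_val_fin_one, Fin.isValue,
    zero_mul, add_zero, zero_add]
  simp only [fderiv_koszulForm_bilin M a hx, koszulForm_bilin M a hx, dKoszulR, dKoszulM,
    bilinR_apply, bilinM_apply, bilinRR_apply, bilinRM_apply, bilinMM_apply, bv_apply, Fin.isValue,
    Fin.reduceEq, if_true, if_false, mul_one, one_mul, mul_zero, zero_mul, add_zero, zero_add,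
    sub_zero, zero_sub]
  simp only [h00, c22r, c22m, c33r, c33m, h00r, h00m, h03r, h03m, h00rr, h00mm, h03rr, scalarH,
    scalarHr, scalarHm, scalarHrr, scalarHmm, sigma, sinSq] at hS hP ⊢
  field_simp
  ring

include hG hx in
/-- A component of `Kerr.Ingoing.ricci_basis`: `Ric(∂_1, ∂_1) = 0` for the Kerr components.
[cite: KerrSchild1965, §3] -/
theorem ricci_basisVector_11 : g'.ricci x (E4.basisVector 1) (E4.basisVector 1) = 0 := by
  have hS := hx.1
  have hP := hx.2
  rw [ricci_basis_aux M a g' hG x hx]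
  simp only [ginvMat, Fin.sum_univ_four, Matrix.of_apply, Matrix.cons_val', Matrix.cons_val_zero,
    Matrix.cons_val_one, Matrix.cons_val, Matrix.empty_val', Matrix.cons_val_fin_one, Fin.isValue,
    zero_mul, add_zero, zero_add]
  simp only [fderiv_koszulForm_bilin M a hx, koszulForm_bilin M a hx, dKoszulR, dKoszulM,
    bilinR_apply, bilinM_apply, bilinRR_apply, bilinRM_apply, bilinMM_apply, bv_apply, Fin.isValue,
    Fin.reduceEq, if_true, if_false, mul_one, one_mul, mul_zero, zero_mul, add_zero, zero_add,
    sub_zero, zero_sub]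
  simp only [h00, c22r, c22m, c33r, c33m, h00r, h00m, h03r, h03m, c22rr, c33rr, h00rr, h00mm,
    h03rr, scalarH, scalarHr, scalarHm, scalarHrr, scalarHmm, sigma, sinSq] at hS hP ⊢
  field_simp
  ring

include hG hx in
/-- A component of `Kerr.Ingoing.ricci_basis`: `Ric(∂_1, ∂_2) = 0` for the Kerr components.
[cite: KerrSchild1965, §3] -/
theorem ricci_basisVector_12 : g'.ricci x (E4.basisVector 1) (E4.basisVector 2) = 0 := by
  have hS := hx.1
  have hP := hx.2
  rw [ricci_basis_aux M a g' hG x hx]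
  simp only [ginvMat, Fin.sum_univ_four, Matrix.of_apply, Matrix.cons_val', Matrix.cons_val_zero,
    Matrix.cons_val_one, Matrix.cons_val, Matrix.empty_val', Matrix.cons_val_fin_one, Fin.isValue,
    zero_mul, add_zero, zero_add]
  simp only [fderiv_koszulForm_bilin M a hx, koszulForm_bilin M a hx, dKoszulR, dKoszulM,
    bilinR_apply, bilinM_apply, bilinRR_apply, bilinRM_apply, bilinMM_apply, bv_apply, Fin.isValue,
    Fin.reduceEq, if_true, if_false, mul_one, one_mul, mul_zero, zero_mul, add_zero, zero_add,
    sub_zero, zero_sub]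
  simp only [h00, c22r, c22m, c33r, c33m, h00r, h00m, h03r, h03m, c22rm, c33rm, h00rm, h03rm,
    scalarH, scalarHr, scalarHm, scalarHrm, sigma, sinSq] at hS hP ⊢
  field_simp
  ring

include hG hx in
/-- A component of `Kerr.Ingoing.ricci_basis`: `Ric(∂_1, ∂_3) = 0` for the Kerr components.
[cite: KerrSchild1965, §3] -/
theorem ricci_basisVector_13 : g'.ricci x (E4.basisVector 1) (E4.basisVector 3) = 0 := by
  have hS := hx.1
  have hP := hx.2
  rw [ricci_basis_aux M a g' hG x hx]
  simp only [ginvMat, Fin.sum_univ_four, Matrix.of_apply, Matrix.cons_val', Matrix.cons_val_zero,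
    Matrix.cons_val_one, Matrix.cons_val, Matrix.empty_val', Matrix.cons_val_fin_one, Fin.isValue,
    zero_mul, add_zero, zero_add]
  simp only [fderiv_koszulForm_bilin M a hx, koszulForm_bilin M a hx, dKoszulR, dKoszulM,
    bilinR_apply, bilinM_apply, bilinRR_apply, bilinRM_apply, bilinMM_apply, bv_apply, Fin.isValue,
    Fin.reduceEq, if_true, if_false, mul_one, one_mul, mul_zero, zero_mul, add_zero, zero_add,
    sub_zero, zero_sub]
  simp only [h00, c22r, c22m, c33r, c33m, h00r, h00m, h03r, h03m, c33rr, h00rr, h00mm, h03rr,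
    h03mm, scalarH, scalarHr, scalarHm, scalarHrr, scalarHmm, sigma, sinSq] at hS hP ⊢
  field_simp
  ring

end Ricci

end Ingoing

end Kerr

end Literature.Geometry.Lorentzian

end
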